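import Literature.NumberTheory.Automorphic.SiegelReducedFamilies
import Literature.NumberTheory.Automorphic.AutomorphicRepsGLCuspFormsRapidDecayMWScaling
import Literature.NumberTheory.Automorphic.SiegelSetAbsorption
import Mathlib.Analysis.Normed.Group.Bounded
import Mathlib.Data.Fintype.Order
import HarnessLib

/-!
# The archimedean Siegel domain lies in the reduced families (stub `stub_sandwich_in`)

Crux `HeckeEigenvalueField` (stmt-Langlands-13632), line `Sketch`.  The Čech-nerve proof of the
Borel–Serre finite-dimensionality theorem for congruence subgroups of `GL_n` over a number field
`K` covers the cone of positive forms over `mixedSpace K = ℝ^{r₁} × ℂ^{r₂}` by translates of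
convex hulls of archimedean Siegel DOMAINS `𝔖 • 1 = {b bᴴ : b ∈ 𝔖}`,
`𝔖 = (A_G · Ω · A_{T₀}(t))_∞` (`Ω ⊆ B(𝔸_K)` a relatively compact piece of the Borel subgroup),
which are compared with the RECURSIVE description `SiegelFamily.IsReduced c C τ n` of families of
complex matrices indexed by the infinite places (`SiegelReducedFamilies`).  This file proves the
registered stub `stub_sandwich_in`, the inclusion `𝔖 • 1 ⊆ R(c, C, τ)`, in two steps.

1. **Linear algebra** (`sandIn_isReduced_mul_conjTranspose`).  For a family `B = (B_w)` of
   upper triangular complex matrices with non-zero diagonal and bounded ratios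
   `‖B_w[i,j]‖ ≤ M ‖B_w[j,j]‖`, `‖B_w[i,i]‖ ≤ M ‖B_{w'}[i,i]‖`, `‖B_w[i+1,i+1]‖ ≤ M ‖B_w[i,i]‖`,
   the family `(B_w B_wᴴ)` is `(M + 1, M² + 1, M² + 1)`-reduced, by induction on the size: the
   last row of `B_w` is `(0, …, 0, β)`, so the pivot is `|β|²`, the last column is `B[j,l] β̄`,
   and the Schur complement of the pivot is `B♭ B♭ᴴ` for the top-left block `B♭`.
2. **The archimedean components of a Siegel-set point** `b = (z(ρ) · ω · diag(a))_∞`: at a place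
   `w`, `b_w = ρ · ω_w · diag(a)` is upper triangular (`GLn.blockTriangular_coe_toMixed`), the
   entries of `ω_w` and `ω_w⁻¹` are bounded on the relatively compact `Ω`, whence
   `|ω_w[i,i]| ≥ 1/Δ` (`ω[i,i] · ω⁻¹[i,i] = 1` on the Borel subgroup), and the cone inequalities
   `t · a_{i+1} ≤ a_i` give the ratio bound; the family of places of `b bᴴ` is `(b_w b_wᴴ)_w`
   because the place evaluations are `⋆`-ring homomorphisms.

## References

* A. Borel, *Introduction aux groupes arithmétiques*, Hermann (1969), §1 (Siegel sets of
  `GL_n(ℝ)` on positive forms), §12–§13 [Borel1969].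
-/

noncomputable section

set_option linter.dupNamespace false -- project-wide: `Summit.Langlands.Langlands` is the mandated namespace

open scoped Pointwise NNReal MatrixGroups ComplexOrder Matrix
open NumberField NumberField.mixedEmbedding IsDedekindDomain Literature.NumberTheory.Automorphic

namespace Summit.Langlands.Langlands.Theorems.HeckeEigenvalueField.Res

/-! ### 1. Linear algebra: `B Bᴴ` for upper triangular `B` -/

section LinearAlgebra

variable {ι : Type*}

/-- `re (z z̄) = ‖z‖²`. [folklore] -/
theorem sandIn_re_mul_star_self (z : ℂ) : (z * star z).re = ‖z‖ ^ 2 := by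
  rw [Complex.star_def, Complex.mul_conj', ← Complex.ofReal_pow, Complex.ofReal_re]

/-- For an upper triangular `A` of size `m + 1` (last row `(0, …, 0, β)`), the last column of
`A Aᴴ` is `(A Aᴴ)[i, m] = A[i, m] · β̄`. [folklore] -/
theorem sandIn_mul_conjTranspose_apply_last {m : ℕ} {A : Matrix (Fin (m + 1)) (Fin (m + 1)) ℂ}
    (hA : ∀ i j, j < i → A i j = 0) (i : Fin (m + 1)) :
    (A * Aᴴ) i (Fin.last m) = A i (Fin.last m) * star (A (Fin.last m) (Fin.last m)) := by
  have h : ∀ k, k ≠ Fin.last m → A i k * Aᴴ k (Fin.last m) = 0 := fun k hk => by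
    rw [Matrix.conjTranspose_apply, hA _ _ (Fin.lt_last_iff_ne_last.mpr hk), star_zero, mul_zero]
  rw [Matrix.mul_apply, Finset.sum_eq_single_of_mem (Fin.last m) (Finset.mem_univ _)
    fun k _ hk => h k hk, Matrix.conjTranspose_apply]

/-- For an upper triangular `A` of size `m + 1`, the last row of `A Aᴴ` is
`(A Aᴴ)[m, j] = β · conj (A[j, m])`. [folklore] -/
theorem sandIn_mul_conjTranspose_last_apply {m : ℕ} {A : Matrix (Fin (m + 1)) (Fin (m + 1)) ℂ}
    (hA : ∀ i j, j < i → A i j = 0) (j : Fin (m + 1)) :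
    (A * Aᴴ) (Fin.last m) j = A (Fin.last m) (Fin.last m) * star (A j (Fin.last m)) := by
  have h : ∀ k, k ≠ Fin.last m → A (Fin.last m) k * Aᴴ k j = 0 := fun k hk => by
    rw [hA _ _ (Fin.lt_last_iff_ne_last.mpr hk), zero_mul]
  rw [Matrix.mul_apply, Finset.sum_eq_single_of_mem (Fin.last m) (Finset.mem_univ _)
    fun k _ hk => h k hk, Matrix.conjTranspose_apply]

/-- The top-left block of `A Aᴴ` (size `m + 1`) is `A♭ A♭ᴴ` plus the rank-one contribution of the
last column, `A♭` the top-left `m × m` block of `A`. [folklore] -/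
theorem sandIn_mul_conjTranspose_castSucc {m : ℕ} (A : Matrix (Fin (m + 1)) (Fin (m + 1)) ℂ)
    (i j : Fin m) :
    (A * Aᴴ) i.castSucc j.castSucc =
      (A.submatrix Fin.castSucc Fin.castSucc * (A.submatrix Fin.castSucc Fin.castSucc)ᴴ) i j +
        A i.castSucc (Fin.last m) * star (A j.castSucc (Fin.last m)) := by
  simp only [Matrix.mul_apply, Matrix.conjTranspose_apply, Matrix.submatrix_apply,
    Fin.sum_univ_castSucc]

/-- A diagonal entry of `A Aᴴ` dominates the squared norm of the corresponding diagonal entry of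
`A`: `(A Aᴴ)[i,i] = ∑ₖ ‖A[i,k]‖² ≥ ‖A[i,i]‖²`. [folklore] -/
theorem sandIn_norm_sq_le_re_mul_conjTranspose {m : ℕ} (A : Matrix (Fin m) (Fin m) ℂ) (i : Fin m) :
    ‖A i i‖ ^ 2 ≤ ((A * Aᴴ) i i).re := by
  rw [Matrix.mul_apply, Complex.re_sum]
  have h : ∀ k, (A i k * Aᴴ k i).re = ‖A i k‖ ^ 2 := fun k => by
    rw [Matrix.conjTranspose_apply, sandIn_re_mul_star_self]
  simp only [h]
  exact Finset.single_le_sum (f := fun k => ‖A i k‖ ^ 2) (fun k _ => sq_nonneg _)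
    (Finset.mem_univ i)

/-- **The Schur complement of the last pivot of `B Bᴴ`, `B` upper triangular with non-zero last
diagonal entry, is `B♭ B♭ᴴ`** for the top-left block `B♭` (the pivot is `|β|²`, the last column
is `B[i,l] β̄`, the last row `β conj B[j,l]`, so the correction term is exactly the rank-one
contribution of the last column of `B`). [folklore] -/
theorem sandIn_schur_mul_conjTranspose {m : ℕ} (B : ι → Matrix (Fin (m + 1)) (Fin (m + 1)) ℂ)
    (hUT : ∀ w i j, j < i → B w i j = 0) (hD : ∀ w, B w (Fin.last m) (Fin.last m) ≠ 0) :
    SiegelFamily.schur (fun w => B w * (B w)ᴴ) = fun w =>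
      (B w).submatrix Fin.castSucc Fin.castSucc * ((B w).submatrix Fin.castSucc Fin.castSucc)ᴴ := by
  funext w
  ext i j
  simp only [SiegelFamily.schur_apply]
  rw [sandIn_mul_conjTranspose_castSucc, sandIn_mul_conjTranspose_apply_last (hUT w) (Fin.last m),
    sandIn_mul_conjTranspose_apply_last (hUT w) i.castSucc,
    sandIn_mul_conjTranspose_last_apply (hUT w) j.castSucc]
  have hne : B w (Fin.last m) (Fin.last m) * star (B w (Fin.last m) (Fin.last m)) ≠ 0 :=
    mul_ne_zero (hD w) (star_ne_zero.mpr (hD w))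
  set S := ((B w).submatrix Fin.castSucc Fin.castSucc *
    ((B w).submatrix Fin.castSucc Fin.castSucc)ᴴ) i j
  set X := B w i.castSucc (Fin.last m)
  set Y := B w j.castSucc (Fin.last m)
  set β := B w (Fin.last m) (Fin.last m)
  rw [show X * star β * (β * star Y) = X * star Y * (β * star β) by ring,
    mul_div_cancel_right₀ _ hne]
  ring

/-- **`B Bᴴ` is a reduced family for upper triangular `B` with controlled ratios** (induction on
the size, peeling the last index through `sandIn_schur_mul_conjTranspose`): if every `B_w` is
upper triangular with non-zero diagonal, `‖B_w[i,j]‖ ≤ M ‖B_w[j,j]‖`,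
`‖B_w[i,i]‖ ≤ M ‖B_{w'}[i,i]‖` and `‖B_w[i+1,i+1]‖ ≤ M ‖B_w[i,i]‖`, then `(B_w B_wᴴ)_w` is
`(M + 1, M² + 1, M² + 1)`-reduced.  This is the computation of the Siegel domain `𝔖 • 1` in the
Cholesky coordinates of the cone of positive forms. [cite: Borel1969, §1, §12–§13] -/
theorem sandIn_isReduced_mul_conjTranspose (M : ℝ) :
    ∀ (m : ℕ) (B : ι → Matrix (Fin m) (Fin m) ℂ),
      (∀ w i j, j < i → B w i j = 0) →
      (∀ w i, 0 < ‖B w i i‖) →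
      (∀ w i j, ‖B w i j‖ ≤ M * ‖B w j j‖) →
      (∀ w w' i, ‖B w i i‖ ≤ M * ‖B w' i i‖) →
      (∀ w (i j : Fin m), (i : ℕ) + 1 = j → ‖B w j j‖ ≤ M * ‖B w i i‖) →
      SiegelFamily.IsReduced (M + 1) (M ^ 2 + 1) (M ^ 2 + 1) m fun w => B w * (B w)ᴴ
  | 0, _, _, _, _, _, _ => SiegelFamily.isReduced_zero _ _ _ _
  | m + 1, B, hUT, hD, hCol, hCross, hRatio => by
    -- the top-left blocks and the induction hypothesis
    set B' : ι → Matrix (Fin m) (Fin m) ℂ := fun w => (B w).submatrix Fin.castSucc Fin.castSucc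
    have IH : SiegelFamily.IsReduced (M + 1) (M ^ 2 + 1) (M ^ 2 + 1) m fun w => B' w * (B' w)ᴴ :=
      sandIn_isReduced_mul_conjTranspose M m B'
        (fun w i j hij => hUT w _ _ (Fin.castSucc_lt_castSucc_iff.mpr hij))
        (fun w i => hD w _) (fun w i j => hCol w _ _) (fun w w' i => hCross w w' _)
        (fun w i j hij => hRatio w _ _ (by simpa using hij))
    have hschur : SiegelFamily.schur (fun w => B w * (B w)ᴴ) = fun w => B' w * (B' w)ᴴ :=
      sandIn_schur_mul_conjTranspose B hUT fun w => norm_pos_iff.mp (hD w _)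
    -- the pivot
    have hpiv : ∀ w, ((B w * (B w)ᴴ) (Fin.last m) (Fin.last m)).re =
        ‖B w (Fin.last m) (Fin.last m)‖ ^ 2 := fun w => by
      rw [sandIn_mul_conjTranspose_apply_last (hUT w), sandIn_re_mul_star_self]
    refine (SiegelFamily.isReduced_succ_iff _ _ _ _).mpr
      ⟨fun w => Matrix.isHermitian_mul_conjTranspose_self _, fun w => ?_, fun w w' => ?_,
        fun w j => ?_, fun w j hj => ?_, ?_⟩
    · -- positivity of the pivot
      rw [hpiv]
      exact pow_pos (hD w _) 2
    · -- comparability across the index set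
      rw [hpiv, hpiv]
      nlinarith [pow_le_pow_left₀ (norm_nonneg _) (hCross w w' (Fin.last m)) 2,
        pow_pos (hD w' (Fin.last m)) 2]
    · -- the last column
      rw [hpiv, sandIn_mul_conjTranspose_apply_last (hUT w), norm_mul, norm_star]
      nlinarith [mul_le_mul_of_nonneg_right (hCol w j.castSucc (Fin.last m))
        (norm_nonneg (B w (Fin.last m) (Fin.last m))), pow_pos (hD w (Fin.last m)) 2]
    · -- the pivot ratio
      rw [hpiv, hschur]
      have h₁ := pow_le_pow_left₀ (norm_nonneg _)
        (hRatio w j.castSucc (Fin.last m) (by simpa using hj)) 2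
      have h₂ : ‖B w j.castSucc j.castSucc‖ ^ 2 ≤ ((B' w * (B' w)ᴴ) j j).re :=
        sandIn_norm_sq_le_re_mul_conjTranspose (B' w) j
      have h₃ := pow_pos (hD w j.castSucc) 2
      calc ‖B w (Fin.last m) (Fin.last m)‖ ^ 2
          < (M ^ 2 + 1) * ‖B w j.castSucc j.castSucc‖ ^ 2 := by nlinarith
        _ ≤ (M ^ 2 + 1) * ((B' w * (B' w)ᴴ) j j).re :=
          mul_le_mul_of_nonneg_left h₂ (by positivity)
    · -- the Schur complement family
      rw [hschur]
      exact IH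

end LinearAlgebra

/-! ### 2. The family of places of a matrix over `K ⊗ ℝ` -/

section Places

variable {K : Type} [Field K]

/-- **The evaluation at an infinite place is a `⋆`-ring homomorphism `mixedSpace K → ℂ`**
computing `SiegelFamily.placeFamily`: at a real place `x ↦ (x_w : ℂ)`, at a complex place
`x ↦ x_w`; it commutes with `star` and sends the real scalar `r` to `r`. [folklore] -/
theorem sandIn_exists_placeHom (w : InfinitePlace K) :
    ∃ φ : mixedSpace K →+* ℂ, (∀ x, φ (star x) = star (φ x)) ∧
      (∀ r : ℝ, φ (algebraMap ℝ (mixedSpace K) r) = r) ∧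
      ∀ {m : ℕ} (H : Matrix (Fin m) (Fin m) (mixedSpace K)),
        SiegelFamily.placeFamily K H w = H.map φ := by
  by_cases hw : w.IsReal
  · refine ⟨Complex.ofRealHom.comp (mixedSpaceEvalReal K ⟨w, hw⟩), fun x => ?_, fun r => ?_,
      fun H => ?_⟩
    · simp
    · simp
    · rw [SiegelFamily.placeFamily_apply_of_isReal H hw]
      rfl
  · have hc : w.IsComplex := InfinitePlace.not_isReal_iff_isComplex.mp hw
    refine ⟨mixedSpaceEvalComplex K ⟨w, hc⟩, fun x => ?_, fun r => ?_, fun H => ?_⟩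
    · simp
    · simp
    · rw [SiegelFamily.placeFamily_apply_of_isComplex H hc]
      rfl

/-- `placeFamily` is multiplicative. [folklore] -/
theorem sandIn_placeFamily_mul {m : ℕ} (A B : Matrix (Fin m) (Fin m) (mixedSpace K))
    (w : InfinitePlace K) :
    SiegelFamily.placeFamily K (A * B) w =
      SiegelFamily.placeFamily K A w * SiegelFamily.placeFamily K B w := by
  obtain ⟨φ, -, -, hφ⟩ := sandIn_exists_placeHom (K := K) w
  rw [hφ, hφ, hφ, Matrix.map_mul]

/-- `placeFamily` commutes with the conjugate transpose. [folklore] -/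
theorem sandIn_placeFamily_conjTranspose {m : ℕ} (A : Matrix (Fin m) (Fin m) (mixedSpace K))
    (w : InfinitePlace K) :
    SiegelFamily.placeFamily K Aᴴ w = (SiegelFamily.placeFamily K A w)ᴴ := by
  obtain ⟨φ, hstar, -, hφ⟩ := sandIn_exists_placeHom (K := K) w
  rw [hφ, hφ, Matrix.conjTranspose_map φ hstar]

variable [NumberField K] {n : ℕ}

/-- **Entries of the archimedean component of a Siegel-set point** `z(ρ) · ω · diag(a)` at a
place `w`: `(ρ ω diag(a))_w[i,j] = ρ · ω_w[i,j] · a_j`. [folklore] -/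
theorem sandIn_placeFamily_toMixed_mul_apply (ρ : ℝ≥0ˣ) (ω : GL (Fin n) (AdeleRing (𝓞 K) K))
    (a : Fin n → ℝ≥0ˣ) (w : InfinitePlace K) (i j : Fin n) :
    SiegelFamily.placeFamily K ((GLn.toMixed n K (posRealScalar n K ρ * ω * posRealDiagonal n K a) :
        GL (Fin n) (mixedSpace K)) : Matrix (Fin n) (Fin n) (mixedSpace K)) w i j =
      (((ρ : ℝ≥0) : ℝ) : ℂ) * SiegelFamily.placeFamily K ((GLn.toMixed n K ω :
        GL (Fin n) (mixedSpace K)) : Matrix (Fin n) (Fin n) (mixedSpace K)) w i j *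
        (((a j : ℝ≥0) : ℝ) : ℂ) := by
  obtain ⟨φ, -, halg, hφ⟩ := sandIn_exists_placeHom (K := K) w
  rw [hφ, hφ, map_mul, map_mul, Units.val_mul, Units.val_mul, GLn.coe_toMixed_posRealScalar,
    GLn.coe_toMixed_posRealDiagonal, Matrix.map_apply, Matrix.map_apply, Matrix.mul_diagonal,
    Matrix.scalar_apply, Matrix.diagonal_mul, map_mul, map_mul, halg, halg]

/-- **Uniform bounds for the archimedean entries of `ω` and `ω⁻¹` on a relatively compact `Ω`**:
there is `Δ ≥ 1` with `‖ω_w[i,j]‖ ≤ Δ` and `‖(ω⁻¹)_w[i,j]‖ ≤ Δ` for all `ω ∈ Ω`, all places `w`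
and all `i, j` (continuity of `ω ↦ ω_∞, ω_∞⁻¹` and compactness of `closure Ω`). [folklore] -/
theorem sandIn_exists_bound (Ω : Set (GL (Fin n) (AdeleRing (𝓞 K) K)))
    (hΩc : IsCompact (closure Ω)) :
    ∃ Δ : ℝ, 1 ≤ Δ ∧ ∀ ω ∈ Ω, ∀ (w : InfinitePlace K) (i j : Fin n),
      ‖SiegelFamily.placeFamily K ((GLn.toMixed n K ω : GL (Fin n) (mixedSpace K)) :
          Matrix (Fin n) (Fin n) (mixedSpace K)) w i j‖ ≤ Δ ∧
      ‖SiegelFamily.placeFamily K (((GLn.toMixed n K ω)⁻¹ : GL (Fin n) (mixedSpace K)) :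
          Matrix (Fin n) (Fin n) (mixedSpace K)) w i j‖ ≤ Δ := by
  have hc₁ : Continuous fun g : GL (Fin n) (AdeleRing (𝓞 K) K) =>
      SiegelFamily.placeFamily K ((GLn.toMixed n K g : GL (Fin n) (mixedSpace K)) :
        Matrix (Fin n) (Fin n) (mixedSpace K)) :=
    (SiegelFamily.continuous_placeFamily n).comp
      (Units.continuous_val.comp (GLn.continuous_toMixed n K))
  have hc₂ : Continuous fun g : GL (Fin n) (AdeleRing (𝓞 K) K) =>
      SiegelFamily.placeFamily K (((GLn.toMixed n K g)⁻¹ : GL (Fin n) (mixedSpace K)) :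
        Matrix (Fin n) (Fin n) (mixedSpace K)) :=
    (SiegelFamily.continuous_placeFamily n).comp
      (Units.continuous_coe_inv.comp (GLn.continuous_toMixed n K))
  have h : ∀ p : InfinitePlace K × Fin n × Fin n, ∃ R : ℝ, ∀ g ∈ closure Ω,
      ‖SiegelFamily.placeFamily K ((GLn.toMixed n K g : GL (Fin n) (mixedSpace K)) :
          Matrix (Fin n) (Fin n) (mixedSpace K)) p.1 p.2.1 p.2.2‖ ≤ R ∧
      ‖SiegelFamily.placeFamily K (((GLn.toMixed n K g)⁻¹ : GL (Fin n) (mixedSpace K)) :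
          Matrix (Fin n) (Fin n) (mixedSpace K)) p.1 p.2.1 p.2.2‖ ≤ R := by
    intro p
    obtain ⟨R₁, hR₁⟩ := hΩc.exists_bound_of_continuousOn
      (((continuous_apply p.1).comp hc₁).matrix_elem p.2.1 p.2.2).continuousOn
    obtain ⟨R₂, hR₂⟩ := hΩc.exists_bound_of_continuousOn
      (((continuous_apply p.1).comp hc₂).matrix_elem p.2.1 p.2.2).continuousOn
    exact ⟨max R₁ R₂, fun g hg =>
      ⟨(hR₁ g hg).trans (le_max_left _ _), (hR₂ g hg).trans (le_max_right _ _)⟩⟩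
  choose R hR using h
  obtain ⟨R₀, hR₀⟩ := Finite.exists_le R
  refine ⟨max 1 R₀, le_max_left _ _, fun ω hω w i j => ?_⟩
  obtain ⟨h₁, h₂⟩ := hR (w, i, j) ω (subset_closure hω)
  exact ⟨h₁.trans ((hR₀ _).trans (le_max_right _ _)), h₂.trans ((hR₀ _).trans (le_max_right _ _))⟩

/-- On the Borel subgroup the archimedean diagonal entries of `ω` and `ω⁻¹` are mutually inverse
at every place: `ω_w[i,i] · (ω⁻¹)_w[i,i] = 1`. [folklore] -/
theorem sandIn_placeFamily_diag_mul_inv {ω : GL (Fin n) (AdeleRing (𝓞 K) K)}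
    (hω : ω ∈ standardParabolicGL (AdeleRing (𝓞 K) K) (id : Fin n → Fin n))
    (w : InfinitePlace K) (i : Fin n) :
    SiegelFamily.placeFamily K ((GLn.toMixed n K ω : GL (Fin n) (mixedSpace K)) :
        Matrix (Fin n) (Fin n) (mixedSpace K)) w i i *
      SiegelFamily.placeFamily K (((GLn.toMixed n K ω)⁻¹ : GL (Fin n) (mixedSpace K)) :
        Matrix (Fin n) (Fin n) (mixedSpace K)) w i i = 1 := by
  obtain ⟨φ, -, -, hφ⟩ := sandIn_exists_placeHom (K := K) w
  have hB : GLn.toMixed n K ω ∈ standardParabolicGL (mixedSpace K) (id : Fin n → Fin n) :=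
    (mem_standardParabolicGL_iff _ _).mpr (GLn.blockTriangular_coe_toMixed hω)
  rw [hφ, hφ, Matrix.map_apply, Matrix.map_apply, ← map_mul, apply_self_mul_inv_apply_self hB i,
    map_one]

end Places

/-! ### 3. The stub -/

/-- **Stub SANDWICH-IN — the archimedean Siegel domain lies in the reduced families**: for a
relatively compact archimedean piece `Ω` of the Borel subgroup and `t > 0`, the matrices `b bᴴ`,
`b` the archimedean component of an element of `A_G · Ω · A_{T₀}(t)`, have `(c, C, τ)`-reduced
families of places for suitable constants (Cholesky coordinates `b_w = u_w D_w`: the peeled pivot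
is `|D_{w,n}|²`, the column ratios are the last column of `u_w`, bounded on `Ω`; the cross-place
ratios are `|m_{w,n} / m_{w',n}|²`, bounded on `Ω`; the pivot ratio is
`(a_n / a_{n-1})² |m_{w,n} / m_{w,n-1}|² ≤ t⁻² · const`; the Schur complement is the same shape in
size `n - 1`).  The hypothesis `Ω ⊆ range GLn.ofInfinite` is not needed for this inclusion.
[cite: Borel1969, §1, §12–§13] -/
theorem stub_sandwich_in (n : ℕ) (K : Type) [Field K] [NumberField K]
    (Ω : Set (GL (Fin n) (AdeleRing (𝓞 K) K)))
    (hΩB : Ω ⊆ (standardParabolicGL (AdeleRing (𝓞 K) K) (id : Fin n → Fin n) :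
      Set (GL (Fin n) (AdeleRing (𝓞 K) K))))
    (_hΩinf : Ω ⊆ Set.range (GLn.ofInfinite n K)) (hΩc : IsCompact (closure Ω))
    (t : ℝ) (ht : 0 < t) :
    ∃ c C τ : ℝ, ∀ b ∈ GLn.toMixed n K ''
        (((posRealScalar n K).range : Set (GL (Fin n) (AdeleRing (𝓞 K) K))) * Ω * siegelCone n K t),
      SiegelFamily.IsReduced c C τ n (SiegelFamily.placeFamily K
        ((b : Matrix (Fin n) (Fin n) (mixedSpace K)) *
          (b : Matrix (Fin n) (Fin n) (mixedSpace K))ᴴ)) := by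
  obtain ⟨Δ, hΔ1, hΔ⟩ := sandIn_exists_bound (K := K) Ω hΩc
  have hΔ0 : 0 < Δ := one_pos.trans_le hΔ1
  set M : ℝ := Δ ^ 2 * (1 + t⁻¹) with hM -- the ratio constant
  have hM₁ : Δ ^ 2 ≤ M := by rw [hM]; nlinarith [inv_pos.mpr ht, sq_nonneg Δ]
  have hM₂ : Δ ^ 2 * t⁻¹ ≤ M := by rw [hM]; nlinarith [sq_nonneg Δ]
  refine ⟨M + 1, M ^ 2 + 1, M ^ 2 + 1, ?_⟩
  rintro b ⟨x, hx, rfl⟩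
  obtain ⟨_, ⟨z, hz, ω, hω, rfl⟩, a, ha, rfl⟩ := hx
  obtain ⟨ρ, rfl⟩ := MonoidHom.mem_range.1 hz
  obtain ⟨α, -, hα, rfl⟩ := mem_siegelCone_iff.1 ha
  -- notation: the archimedean components at the places
  set g : GL (Fin n) (mixedSpace K) :=
    GLn.toMixed n K (posRealScalar n K ρ * ω * posRealDiagonal n K α)
  set B : InfinitePlace K → Matrix (Fin n) (Fin n) ℂ :=
    SiegelFamily.placeFamily K (g : Matrix (Fin n) (Fin n) (mixedSpace K))
  set P : InfinitePlace K → Matrix (Fin n) (Fin n) ℂ :=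
    SiegelFamily.placeFamily K ((GLn.toMixed n K ω : GL (Fin n) (mixedSpace K)) :
      Matrix (Fin n) (Fin n) (mixedSpace K)) with hP
  -- the family of places of `b bᴴ` is `(B_w B_wᴴ)_w`
  have hfam : SiegelFamily.placeFamily K ((g : Matrix (Fin n) (Fin n) (mixedSpace K)) *
      (g : Matrix (Fin n) (Fin n) (mixedSpace K))ᴴ) = fun w => B w * (B w)ᴴ := by
    funext w
    rw [sandIn_placeFamily_mul, sandIn_placeFamily_conjTranspose]
  rw [hfam]
  have hρ : 0 < ((ρ : ℝ≥0) : ℝ) := NNReal.coe_pos.mpr (pos_iff_ne_zero.mpr ρ.ne_zero)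
  have hαpos : ∀ i, 0 < ((α i : ℝ≥0) : ℝ) := fun i =>
    NNReal.coe_pos.mpr (pos_iff_ne_zero.mpr (α i).ne_zero)
  have hentry : ∀ w i j, B w i j = (((ρ : ℝ≥0) : ℝ) : ℂ) * P w i j * (((α j : ℝ≥0) : ℝ) : ℂ) :=
    fun w i j => sandIn_placeFamily_toMixed_mul_apply ρ ω α w i j
  have hnorm : ∀ w i j, ‖B w i j‖ = ((ρ : ℝ≥0) : ℝ) * ‖P w i j‖ * ((α j : ℝ≥0) : ℝ) :=
    fun w i j => by rw [hentry, norm_mul, norm_mul, Complex.norm_real, Complex.norm_real,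
      Real.norm_of_nonneg hρ.le, Real.norm_of_nonneg (hαpos j).le]
  -- bounds for the entries of `ω_w`: `‖P w i j‖ ≤ Δ` and `1 ≤ Δ ‖P w i i‖`
  have hPle : ∀ w i j, ‖P w i j‖ ≤ Δ := fun w i j => (hΔ ω hω w i j).1
  have hPge : ∀ w i, 1 ≤ Δ * ‖P w i i‖ := fun w i => by
    have h₁ := congrArg (fun z : ℂ => ‖z‖) (sandIn_placeFamily_diag_mul_inv (hΩB hω) w i)
    simp only [norm_mul, norm_one] at h₁
    calc (1 : ℝ) = _ := h₁.symm
      _ ≤ ‖P w i i‖ * Δ := mul_le_mul_of_nonneg_left (hΔ ω hω w i i).2 (norm_nonneg _)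
      _ = Δ * ‖P w i i‖ := mul_comm _ _
  -- the key comparison `ρ a_i ≤ Δ ‖B w i i‖`
  have hkey : ∀ w i, ((ρ : ℝ≥0) : ℝ) * ((α i : ℝ≥0) : ℝ) ≤ Δ * ‖B w i i‖ := fun w i => by
    rw [hnorm]
    nlinarith [mul_le_mul_of_nonneg_left (hPge w i) (mul_pos hρ (hαpos i)).le]
  have hup : ∀ w i j, ‖B w i j‖ ≤ Δ * (((ρ : ℝ≥0) : ℝ) * ((α j : ℝ≥0) : ℝ)) := fun w i j => by
    rw [hnorm]
    nlinarith [mul_le_mul_of_nonneg_left (hPle w i j) (mul_pos hρ (hαpos j)).le]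
  refine sandIn_isReduced_mul_conjTranspose M n B (fun w i j hij => ?_) (fun w i => ?_)
    (fun w i j => ?_) (fun w w' i => ?_) (fun w i j hij => ?_)
  · -- upper triangular
    obtain ⟨φ, -, -, hφ⟩ := sandIn_exists_placeHom (K := K) w
    rw [hentry, hP, hφ, Matrix.map_apply, GLn.blockTriangular_coe_toMixed (hΩB hω) hij, map_zero,
      mul_zero, zero_mul]
  · -- non-zero diagonal
    exact pos_of_mul_pos_right ((mul_pos hρ (hαpos i)).trans_le (hkey w i)) hΔ0.le
  · -- column ratios
    calc ‖B w i j‖ ≤ Δ * (((ρ : ℝ≥0) : ℝ) * ((α j : ℝ≥0) : ℝ)) := hup w i j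
      _ ≤ Δ * (Δ * ‖B w j j‖) := mul_le_mul_of_nonneg_left (hkey w j) hΔ0.le
      _ = Δ ^ 2 * ‖B w j j‖ := by ring
      _ ≤ M * ‖B w j j‖ := mul_le_mul_of_nonneg_right hM₁ (norm_nonneg _)
  · -- cross-place ratios
    calc ‖B w i i‖ ≤ Δ * (((ρ : ℝ≥0) : ℝ) * ((α i : ℝ≥0) : ℝ)) := hup w i i
      _ ≤ Δ * (Δ * ‖B w' i i‖) := mul_le_mul_of_nonneg_left (hkey w' i) hΔ0.le
      _ = Δ ^ 2 * ‖B w' i i‖ := by ring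
      _ ≤ M * ‖B w' i i‖ := mul_le_mul_of_nonneg_right hM₁ (norm_nonneg _)
  · -- successive pivot ratios, from the cone inequalities `t a_j ≤ a_i`
    have hcone : ((α j : ℝ≥0) : ℝ) ≤ t⁻¹ * ((α i : ℝ≥0) : ℝ) := by
      rw [← div_eq_inv_mul, le_div_iff₀ ht, mul_comm]
      exact hα i j hij.symm
    calc ‖B w j j‖ ≤ Δ * (((ρ : ℝ≥0) : ℝ) * ((α j : ℝ≥0) : ℝ)) := hup w j j
      _ ≤ Δ * (((ρ : ℝ≥0) : ℝ) * (t⁻¹ * ((α i : ℝ≥0) : ℝ))) :=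
          mul_le_mul_of_nonneg_left (mul_le_mul_of_nonneg_left hcone hρ.le) hΔ0.le
      _ = Δ * t⁻¹ * (((ρ : ℝ≥0) : ℝ) * ((α i : ℝ≥0) : ℝ)) := by ring
      _ ≤ Δ * t⁻¹ * (Δ * ‖B w i i‖) :=
          mul_le_mul_of_nonneg_left (hkey w i) (mul_nonneg hΔ0.le (inv_pos.mpr ht).le)
      _ = Δ ^ 2 * t⁻¹ * ‖B w i i‖ := by ring
      _ ≤ M * ‖B w i i‖ := mul_le_mul_of_nonneg_right hM₂ (norm_nonneg _)

end Summit.Langlands.Langlands.Theorems.HeckeEigenvalueField.Res
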